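import Summits.RiemannHypothesis.RiemannHypothesis.Theses.RuelleBand
import Literature.Barriers.RiemannHypothesis.EpsteinZetaRealZerosProofs
import Literature.Barriers.RiemannHypothesis.EpsteinZetaStark
import Summits.RiemannHypothesis.RiemannHypothesis.Theorems.AsymptoticCriticalLine.Negative.DavenportHeilbronnBand

/-!
# `ExactFirstBand` (crux stmt-RiemannHypothesis-2061, route RuelleBand) — the DFG shape in the no-Euler-product models

Negative-side support file of the crux disprover (cdisprove seat, cycle 1). The crux (thesis X) has the SHAPE
"every zero in the open strip lies on `σ = 1/2` or on the real axis" (Dyatlov–Faure–Guillarmou's first band: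
the line plus finitely many real exceptional resonances). The shape is tested on the two classical families
with a Riemann-type functional equation and no Euler product; everything below is unconditional and rests on
theorems PROVED in the tree.

* `not_exactFirstBand_shape_davenportHeilbronn` — the verbatim shape (with `davenportHeilbronn` for
  `riemannZeta`) is FALSE for the Davenport–Heilbronn quintic `f` (Saias–Weingartner: `≫ T` zeros in
  `3/4 < σ < 1`; identity theorem).
* (companion file `ModelShapesClassNumberTwo`: the side-condition-free forms of X are FALSE for `ζ_{x²+5y²}`,
  `h(-20) = 2` — Davenport–Heilbronn 1936, a non-real zero in `σ > 1`.)
* `exists_real_exceptional_zero_epstein` — the real-exceptional clause is LIVE: `ζ_{x²+64y²}` (`k = 8`) has a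
  real zero in `(1/2, 1)` (Bateman–Grosswald); for `ζ` the clause is void.
* `exactFirstBand_shape_epstein_low` — X's shape IS Stark's theorem: for `k > K` the zeros of `ζ_Q` with
  `-1 < σ < 2`, `|t| ≤ 2k` lie on `σ = 1/2` or are real, with a genuine real pair.
Moral: the shape is produced by functional equation + domination, coexists with the failure of RH, and fails
higher up without an Euler product; for `ζ` it carries no information beyond RH itself. Barrier entries
engaged: `DavenportHeilbronn(Narrow)`, `EpsteinZetaRealZeros`.
-/

noncomputable section

open Complex Set Filter Topology

namespace Summit.RiemannHypothesis.Cruxes.ExactFirstBand.Negative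

open Literature.Barriers.RiemannHypothesis
open Summit.RiemannHypothesis.RiemannHypothesis.Theorems.AsymptoticCriticalLine.Negative
  (dhChar dhWeight dhChar_isPrimitive dhSigma_injective dhP_ok dh_sum_eq)

/-- MODEL KILL 1 (verbatim shape of X, `davenportHeilbronn` for `riemannZeta`): the Davenport–Heilbronn
function `f` (entire, `5`-periodic coefficients, odd conductor-`5` Riemann-type functional equation,
infinitely many zeros ON `σ = 1/2`) violates X's shape in the open strip. Proof: Saias–Weingartner (tree,
PROVED) gives `≥ cT` zeros with `3/4 < σ < 1`, `|t| ≤ T`; under the shape they are all real, hence infinitely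
many zeros in the compact segment `[3/4, 1]`, so `f ≡ 0` by the identity theorem — but then `f(3/4 + i) = 0`
violates the shape. [cite: Titchmarsh1986, §10.25] [cite: SaiasWeingartner2009, Thm. 2] -/
theorem not_exactFirstBand_shape_davenportHeilbronn :
    ¬ ∀ s : ℂ, davenportHeilbronn s = 0 → 0 < s.re → s.re < 1 → s.re = 1 / 2 ∨ s.im = 0 := by
  intro hX
  obtain ⟨η, _, hstrip⟩ :=
    SaiasWeingartner_holds Bool (fun _ => 5) dhChar (fun b => dhWeight b • LSeries.delta) (by simp)
      dhChar_isPrimitive dhSigma_injective dhP_ok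
  obtain ⟨c, hc, T₀, hT⟩ := hstrip (3 / 4) 1 (by norm_num) (by norm_num) (by linarith)
  set S : Set ℂ := {s : ℂ | davenportHeilbronn s = 0 ∧ 3 / 4 ≤ s.re ∧ s.re ≤ 1 ∧ s.im = 0} with hS
  have hinf : S.Infinite := by
    intro hfin
    set N : ℕ := hfin.toFinset.card with hN
    obtain ⟨Z, hZcard, hZ⟩ := hT (max T₀ (((N : ℝ) + 1) / c)) (le_max_left _ _)
    have hZsub : ∀ s ∈ Z, s ∈ S := by
      intro s hs
      obtain ⟨h1, h2, _, h4⟩ := hZ s hs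
      rw [dh_sum_eq] at h4
      refine ⟨h4, h1.le, h2.le, ?_⟩
      rcases hX s h4 (by linarith) h2 with h | h
      · exfalso; linarith
      · exact h
    have hcard : Z.card ≤ N :=
      Finset.card_le_card fun s hs => (Set.Finite.mem_toFinset hfin).2 (hZsub s hs)
    have hge : (N : ℝ) + 1 ≤ c * max T₀ (((N : ℝ) + 1) / c) :=
      calc (N : ℝ) + 1 = c * (((N : ℝ) + 1) / c) := by field_simp
        _ ≤ c * max T₀ (((N : ℝ) + 1) / c) := by gcongr; exact le_max_right _ _
    have h1 : (N : ℝ) + 1 ≤ Z.card := hge.trans hZcard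
    have h2 : (Z.card : ℝ) ≤ N := by exact_mod_cast hcard
    linarith
  have hK : IsCompact (Icc (3 / 4 : ℝ) 1 ×ℂ Icc (0 : ℝ) 0) := isCompact_Icc.reProdIm isCompact_Icc
  have hsub : S ⊆ Icc (3 / 4 : ℝ) 1 ×ℂ Icc (0 : ℝ) 0 := by
    rintro s ⟨-, h1, h2, h3⟩
    exact Complex.mem_reProdIm.2 ⟨⟨h1, h2⟩, by simp [h3]⟩
  obtain ⟨z, -, hz⟩ := hinf.exists_accPt_of_subset_isCompact hK hsub
  have hfreq : ∃ᶠ w in 𝓝[≠] z, davenportHeilbronn w = 0 :=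
    (accPt_iff_frequently_nhdsNE.mp hz).mono fun w hw => hw.1
  have han : AnalyticOnNhd ℂ davenportHeilbronn Set.univ := fun w _ =>
    differentiable_davenportHeilbronn.analyticAt w
  have h0 : davenportHeilbronn (3 / 4 + I) = 0 :=
    han.eqOn_zero_of_preconnected_of_frequently_eq_zero isPreconnected_univ (Set.mem_univ z) hfreq
      (Set.mem_univ _)
  rcases hX _ h0 (by norm_num) (by norm_num) with h | h <;> norm_num at h

/-- THE REAL-EXCEPTIONAL CLAUSE IS LIVE for Epstein zeta functions: `Q = x² + 64y²` has Stark parameter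
`k = √256/2 = 8 > 7.0556`, so EVERY analytic continuation `Z` of `ζ_Q` has a real zero `β ∈ (1/2, 1)`
(Bateman–Grosswald 1964, tree `BatemanGrosswald1964_realZero_holds`, PROVED), and a continuation exists (tree
`MontgomeryVaughan2007_epsteinContinuation_holds`, PROVED). For `ζ` this clause is void.
[cite: Stark1967EpsteinZeros, §1] [cite: BatemanGrosswald1964, Theorem 3] -/
theorem exists_real_exceptional_zero_epstein :
    ∃ Z : ℂ → ℂ, IsEpsteinContinuation 1 0 64 Z ∧ ∃ σ : ℝ, 1 / 2 < σ ∧ σ < 1 ∧ Z σ = 0 := by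
  have hQ : IsPosDefForm (1 : ℝ) 0 64 := ⟨one_pos, by norm_num⟩
  obtain ⟨Z, hZ, -⟩ := MontgomeryVaughan2007_epsteinContinuation_holds 1 0 64 hQ
  have hk : (7.0556 : ℝ) < starkK 1 0 64 := by
    rw [starkK_one, show (4 : ℝ) * 64 - 0 ^ 2 = 16 ^ 2 by norm_num, Real.sqrt_sq (by norm_num)]
    norm_num
  exact ⟨Z, hZ, BatemanGrosswald1964_realZero_holds 1 0 64 hQ hk Z hZ⟩

/-- X'S SHAPE **IS** STARK'S THEOREM (tree `Stark1967_thm1_holds`, PROVED, `K` ineffective): for every positive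
definite `Q` with `k > K` and every continuation `Z` of `ζ_Q`, the zeros in the box `-1 < σ < 2`, `|t| ≤ 2k`
(`s ≠ 1`) lie on `σ = 1/2` OR ARE REAL — the DFG first-band shape "line plus finitely many real exceptional
resonances", realised by a Dirichlet series WITHOUT Euler product and WITH a genuine real pair
`β₁ = 1 - β₂`, `β₂ ∈ (1/2, 1)`. [cite: Stark1967EpsteinZeros, Theorem 1] -/
theorem exactFirstBand_shape_epstein_low :
    ∃ K : ℝ, ∀ a b c : ℝ, IsPosDefForm a b c → K < starkK a b c →
      ∀ Z : ℂ → ℂ, IsEpsteinContinuation a b c Z →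
        (∀ s ∈ starkBox (starkK a b c), s ≠ 1 → Z s = 0 → s.re = 1 / 2 ∨ s.im = 0) ∧
        ∃ β : ℝ, 1 / 2 < β ∧ β < 1 ∧ Z β = 0 := by
  obtain ⟨K, hK⟩ := Stark1967_thm1_holds
  refine ⟨K, fun a b c hQ hk Z hZ => ?_⟩
  obtain ⟨-, β₁, β₂, -, -, h21, h22, -, -, hZ2, hall⟩ := hK a b c hQ hk Z hZ
  refine ⟨fun s hs h1 h0 => ?_, β₂, h21, h22, hZ2⟩
  rcases hall s hs h1 h0 with h | h | h
  · exact Or.inl h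
  · exact Or.inr (by rw [h, ofReal_im])
  · exact Or.inr (by rw [h, ofReal_im])

end Summit.RiemannHypothesis.Cruxes.ExactFirstBand.Negative

end
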